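import Summits.Ventures.Crystal3D.Theorems.StickyWulffConstantPolycrystalWulffBoundLineTrim
import Summits.Ventures.Crystal3D.Theorems.StickyWulffConstantPolycrystalWulffBoundPrismShear

/-!
# The line-of-sight trimming estimate in `E3`, with the shadow converted to a facet area
# (general single-axis rung of `PolycrystalWulffBound`, line `PolyDensity`, crux `stmt-Ventures-19482`)

Route `StickyWulffConstant` of the venture `Summits/Ventures/Crystal3D`, second prover lane (poly-p2,
gen 10).  Packaging of `…LineTrim` (p637101, in `Fin 3 → ℝ`) and `…PrismShear` (p637862) for the rung:
for disjoint open convex cells `P, Q ⊆ E3` (`Q` bounded), a unit vector `w` completed to an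
orthonormal triple `(u, w, m)`, and a plane `{⟪ν, x⟫ = b}` (`‖ν‖ = 1`) containing `closure P ∩ closure Q`:
for every `ε > 0` there is `ρ₀ > 0` such that for all `0 < ρ < ρ₀`
`volume (Q ∩ {x | ∃ s ∈ [−ρ, ρ], x + s·w ∈ P}) ≤ ρ · (|⟪w, ν⟫| · facetArea (closure P ∩ closure Q) ν + ε)`
(`volume_lineTrimE3_le`).  Steps: an orthonormal frame `T x = (⟪u,x⟫, ⟪w,x⟫, ⟪m,x⟫)` (volume
preserving, `T (x + s w) = T x + s e₁`); `volume_lineTrim_le_shadow`; the shadow of a compact set is at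
most the volume of its unit `e₁`-prism (`volume_shadow_le_volume_prism`); the prism is the image of
`F + [0,1]·w`; `volume_prism_shear`.
WHAT THIS IS NOT: the rung; the crux is not claimed.
-/

noncomputable section

open scoped BigOperators InnerProductSpace ENNReal Pointwise
open MeasureTheory Set

namespace Summit.Ventures.Crystal3D.Theorems

open Summit.Ventures.Crystal3D.Cruxes.TextureLiminf.TexShadow (E3 facetArea)

/-- **The shadow is at most the prism**: for `S ⊆ Fin 3 → ℝ`, the planar measure of the projection
`(x 0, x 2)` of `S` is at most the volume of `S + [0,1]·e₁`. -/
theorem volume_shadow_le_volume_prism {S : Set (Fin 3 → ℝ)} (hS : IsCompact S) :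
    volume ((fun x : Fin 3 → ℝ => (x 0, x 2)) '' S) ≤
      volume {z : Fin 3 → ℝ | ∃ y ∈ S, ∃ t ∈ Icc (0 : ℝ) 1, z = y + t • (![0, 1, 0] : Fin 3 → ℝ)} := by
  set Z : Set (Fin 3 → ℝ) := {z | ∃ y ∈ S, ∃ t ∈ Icc (0 : ℝ) 1, z = y + t • (![0, 1, 0] : Fin 3 → ℝ)}
    with hZ
  set F : Set (ℝ × ℝ) := (fun x : Fin 3 → ℝ => (x 0, x 2)) '' S with hF
  -- `Z` is compact (continuous image of `S × [0,1]`), hence measurable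
  have hZc : IsCompact Z := by
    have hc : Continuous fun q : (Fin 3 → ℝ) × ℝ => q.1 + q.2 • (![0, 1, 0] : Fin 3 → ℝ) :=
      continuous_fst.add (continuous_snd.smul continuous_const)
    have he : Z = (fun q : (Fin 3 → ℝ) × ℝ => q.1 + q.2 • (![0, 1, 0] : Fin 3 → ℝ)) '' (S ×ˢ Icc (0 : ℝ) 1) := by
      ext z
      simp only [hZ, mem_setOf_eq, mem_image, mem_prod, Prod.exists]
      constructor
      · rintro ⟨y, hy, t, ht, rfl⟩; exact ⟨y, t, ⟨hy, ht⟩, rfl⟩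
      · rintro ⟨y, t, ⟨hy, ht⟩, rfl⟩; exact ⟨y, hy, t, ht, rfl⟩
    rw [he]
    exact (hS.prod isCompact_Icc).image hc
  have hZm : MeasurableSet Z := hZc.isClosed.measurableSet
  have hFc : IsCompact F := hS.image ((continuous_apply 0).prodMk (continuous_apply 2))
  have hFm : MeasurableSet F := hFc.isClosed.measurableSet
  -- fibres of `Z` over the shadow have length `≥ 1`
  have hfib : ∀ t ξ : ℝ, F.indicator 1 (ξ, t) ≤ volume {y : ℝ | (![ξ, y, t] : Fin 3 → ℝ) ∈ Z} := by
    intro t ξ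
    by_cases h : (ξ, t) ∈ F
    · rw [indicator_of_mem h, Pi.one_apply]
      obtain ⟨x, hx, hxp⟩ := h
      simp only [Prod.mk.injEq] at hxp
      have hsub : Icc (x 1) (x 1 + 1) ⊆ {y : ℝ | (![ξ, y, t] : Fin 3 → ℝ) ∈ Z} := by
        intro y hy
        refine ⟨x, hx, y - x 1, ⟨by linarith [hy.1], by linarith [hy.2]⟩, ?_⟩
        ext i; fin_cases i
        · simp [hxp.1]
        · simp
        · simp [hxp.2]
      calc (1 : ℝ≥0∞) = volume (Icc (x 1) (x 1 + 1)) := by rw [Real.volume_Icc]; simp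
        _ ≤ _ := measure_mono hsub
    · rw [indicator_of_notMem h]; exact bot_le
  have hL : volume F = ∫⁻ t, volume ((fun x : ℝ => (x, t)) ⁻¹' F) := by
    rw [Measure.volume_eq_prod, Measure.prod_apply_symm hFm]
  rw [hL, volume_eq_lintegral_slice3 Z hZm]
  refine lintegral_mono fun t => ?_
  rw [Chimera.volume_eq_lintegral_fibre2 _ (Chimera.measurableSet_slice3 hZm t)]
  have hind : (fun ξ : ℝ => F.indicator (1 : ℝ × ℝ → ℝ≥0∞) (ξ, t)) =
      ((fun x : ℝ => (x, t)) ⁻¹' F).indicator 1 := by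
    funext ξ; by_cases hξ : (ξ, t) ∈ F <;> simp [hξ]
  rw [← lintegral_indicator_one (hFm.preimage measurable_prodMk_right), ← hind]
  refine lintegral_mono fun ξ => ?_
  rw [Chimera.fibre_slice3]
  exact hfib t ξ

/-- **Line-of-sight trimming estimate in `E3`.**  Disjoint open convex `P, Q ⊆ E3`, `Q` bounded,
`(u, w, m)` orthonormal, `closure P ∩ closure Q ⊆ {⟪ν, x⟫ = b}` with `‖ν‖ = 1`: for every `ε > 0`
there is `ρ₀ > 0` with `|Q ∩ {x | ∃ s ∈ [−ρ,ρ], x + s w ∈ P}| ≤ ρ·(|⟪w,ν⟫|·facetArea(cl P ∩ cl Q) ν + ε)`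
for all `0 < ρ < ρ₀`. -/
theorem volume_lineTrimE3_le (u w m : E3) (hu : ‖u‖ = 1) (hw : ‖w‖ = 1) (hm : ‖m‖ = 1)
    (hum : ⟪u, m⟫_ℝ = 0) (hwm : ⟪w, m⟫_ℝ = 0) (hwu : ⟪w, u⟫_ℝ = 0)
    {P Q : Set E3} (hPo : IsOpen P) (hQo : IsOpen Q) (hPv : Convex ℝ P) (hQv : Convex ℝ Q)
    (hPQ : Disjoint P Q) (hQb : Bornology.IsBounded Q)
    {ν : E3} (hν : ‖ν‖ = 1) {b : ℝ} (hpl : closure P ∩ closure Q ⊆ {x : E3 | ⟪ν, x⟫_ℝ = b})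
    {ε : ℝ} (hε : 0 < ε) :
    ∃ ρ₀ : ℝ, 0 < ρ₀ ∧ ∀ ρ : ℝ, 0 < ρ → ρ < ρ₀ →
      (volume (Q ∩ {x : E3 | ∃ s ∈ Icc (-ρ) ρ, x + s • w ∈ P})).toReal ≤
        ρ * (|⟪w, ν⟫_ℝ| * facetArea (closure P ∩ closure Q) ν + ε) := by
  classical
  -- the orthonormal frame `(u, w, m)` and the transport `T x = (⟪u,x⟫, ⟪w,x⟫, ⟪m,x⟫)`
  set v : Fin 3 → E3 := ![u, w, m] with hv
  have hmu : ⟪m, u⟫_ℝ = 0 := by rw [real_inner_comm]; exact hum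
  have hmw : ⟪m, w⟫_ℝ = 0 := by rw [real_inner_comm]; exact hwm
  have huw : ⟪u, w⟫_ℝ = 0 := by rw [real_inner_comm]; exact hwu
  have hvon : Orthonormal ℝ v := by
    rw [orthonormal_iff_ite]
    intro i j
    fin_cases i <;> fin_cases j <;> simp [hv, hu, hw, hm, hum, hwm, hwu, hmu, hmw, huw]
  have hvsp : ⊤ ≤ Submodule.span ℝ (Set.range v) :=
    (hvon.linearIndependent.span_eq_top_of_card_eq_finrank' (by simp)).ge
  set bON : OrthonormalBasis (Fin 3) ℝ E3 := OrthonormalBasis.mk hvon hvsp with hbON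
  have hbv : ∀ i, bON i = v i := fun i => by rw [hbON, OrthonormalBasis.coe_mk]
  set Th : E3 ≃ₜ (Fin 3 → ℝ) := bON.repr.toContinuousLinearEquiv.toHomeomorph.trans
    (PiLp.continuousLinearEquiv 2 ℝ (fun _ : Fin 3 => ℝ)).toHomeomorph with hTh
  set T : E3 ≃ᵐ (Fin 3 → ℝ) := Th.toMeasurableEquiv with hT
  have hTfun : ∀ x, T x = WithLp.ofLp (bON.repr x) := fun x => rfl
  have hThT : ∀ x, Th x = T x := fun x => rfl
  have hTi : ∀ x i, (T x) i = ⟪v i, x⟫_ℝ := by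
    intro x i
    rw [hTfun, ← hbv, ← OrthonormalBasis.repr_apply_apply]
  have hTeq : ∀ x, T x = ![⟪u, x⟫_ℝ, ⟪w, x⟫_ℝ, ⟪m, x⟫_ℝ] := by
    intro x; ext i; fin_cases i <;> rw [hTi] <;> rfl
  have hTmp : MeasurePreserving T volume volume := by
    have h := (PiLp.volume_preserving_ofLp (Fin 3)).comp bON.repr.measurePreserving
    exact h
  have hTvol : ∀ X : Set E3, MeasurableSet X → volume (T '' X) = volume X := fun X hX => by
    rw [MeasurableEquiv.image_eq_preimage_symm]; exact hTmp.symm.measure_preimage hX.nullMeasurableSet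
  have hTadd : ∀ x y : E3, T (x + y) = T x + T y := fun x y => by
    rw [hTfun, hTfun, hTfun, map_add]; rfl
  have hTsmul : ∀ (c : ℝ) (x : E3), T (c • x) = c • T x := fun c x => by
    rw [hTfun, hTfun, map_smul]; rfl
  have hTlin : IsLinearMap ℝ (T : E3 → Fin 3 → ℝ) := ⟨hTadd, hTsmul⟩
  have hmemT : ∀ (X : Set E3) (z : Fin 3 → ℝ), z ∈ T '' X ↔ T.symm z ∈ X := fun X z => by
    rw [MeasurableEquiv.image_eq_preimage_symm, mem_preimage]
  have hTw : T w = ![0, 1, 0] := by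
    rw [hTeq]; simp only [huw, real_inner_self_eq_norm_sq, hw, one_pow, hmw]
  have hTsw : ∀ (x : E3) (s : ℝ), T (x + s • w) = T x + s • (![0, 1, 0] : Fin 3 → ℝ) := by
    intro x s; rw [hTadd, hTsmul, hTw]
  -- images: open, convex, disjoint, bounded; closures commute
  have hTimg : ∀ X : Set E3, T '' X = Th '' X := fun X => rfl
  have hPo' : IsOpen (T '' P) := by rw [hTimg]; exact Th.isOpenMap P hPo
  have hQo' : IsOpen (T '' Q) := by rw [hTimg]; exact Th.isOpenMap Q hQo
  have hPv' : Convex ℝ (T '' P) := hPv.is_linear_image hTlin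
  have hQv' : Convex ℝ (T '' Q) := hQv.is_linear_image hTlin
  have hPQ' : Disjoint (T '' P) (T '' Q) := (Set.disjoint_image_iff T.injective).2 hPQ
  have hQb' : Bornology.IsBounded (T '' Q) := by
    obtain ⟨R, hR⟩ := hQb.subset_closedBall 0
    refine (Metric.isBounded_closedBall (x := (0 : Fin 3 → ℝ)) (r := R)).subset ?_
    rintro z ⟨x, hx, rfl⟩
    have hxR : ‖x‖ ≤ R := mem_closedBall_zero_iff.1 (hR hx)
    have hR0 : 0 ≤ R := le_trans (norm_nonneg _) hxR
    rw [mem_closedBall_zero_iff, pi_norm_le_iff_of_nonneg hR0]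
    intro i
    rw [hTi, Real.norm_eq_abs]
    calc |⟪v i, x⟫_ℝ| ≤ ‖v i‖ * ‖x‖ := abs_real_inner_le_norm _ _
      _ = ‖x‖ := by rw [← hbv, bON.orthonormal.1 i, one_mul]
      _ ≤ R := hxR
  have hcl : closure (T '' P) ∩ closure (T '' Q) = T '' (closure P ∩ closure Q) := by
    rw [hTimg, hTimg, hTimg, ← Th.image_closure, ← Th.image_closure,
      Set.image_inter Th.injective]
  -- the trimmed set and its image
  have htrimimg : ∀ ρ : ℝ, T '' (Q ∩ {x : E3 | ∃ s ∈ Icc (-ρ) ρ, x + s • w ∈ P}) =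
      T '' Q ∩ {z : Fin 3 → ℝ | ∃ s ∈ Icc (-ρ) ρ, z + s • (![0, 1, 0] : Fin 3 → ℝ) ∈ T '' P} := by
    intro ρ
    ext z
    have hz : ∀ s : ℝ, T.symm (z + s • (![0, 1, 0] : Fin 3 → ℝ)) = T.symm z + s • w := by
      intro s; apply T.injective; rw [T.apply_symm_apply, hTsw, T.apply_symm_apply]
    simp only [mem_inter_iff, mem_setOf_eq, hmemT, hz]
  -- the facet: compact, in the plane; its shadow ≤ |⟪w,ν⟫|·facetArea
  set Fc : Set E3 := closure P ∩ closure Q with hFc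
  have hFcpt : IsCompact Fc := (hQb.isCompact_closure).inter_left isClosed_closure
  have hshadow : volume ((fun x : Fin 3 → ℝ => (x 0, x 2)) '' (T '' Fc)) ≤
      ENNReal.ofReal (|⟪w, ν⟫_ℝ| * facetArea Fc ν) := by
    have h1 := volume_shadow_le_volume_prism (hFcpt.image Th.continuous)
    rw [← hTimg] at h1
    have hprism : {z : Fin 3 → ℝ | ∃ y ∈ T '' Fc, ∃ t ∈ Icc (0 : ℝ) 1, z = y + t • (![0, 1, 0] : Fin 3 → ℝ)} =
        T '' {x : E3 | ∃ y ∈ Fc, ∃ t ∈ Icc (0 : ℝ) 1, x = y + t • w} := by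
      ext z
      simp only [mem_setOf_eq, mem_image]
      constructor
      · rintro ⟨_, ⟨y, hy, rfl⟩, t, ht, rfl⟩
        exact ⟨y + t • w, ⟨y, hy, t, ht, rfl⟩, hTsw y t⟩
      · rintro ⟨_, ⟨y, hy, t, ht, rfl⟩, rfl⟩
        exact ⟨T y, ⟨y, hy, rfl⟩, t, ht, hTsw y t⟩
    have hWm : MeasurableSet {x : E3 | ∃ y ∈ Fc, ∃ t ∈ Icc (0 : ℝ) 1, x = y + t • w} := by
      have hc : Continuous fun q : E3 × ℝ => q.1 + q.2 • w :=
        continuous_fst.add (continuous_snd.smul continuous_const)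
      have he : {x : E3 | ∃ y ∈ Fc, ∃ t ∈ Icc (0 : ℝ) 1, x = y + t • w} =
          (fun q : E3 × ℝ => q.1 + q.2 • w) '' (Fc ×ˢ Icc (0 : ℝ) 1) := by
        ext x
        simp only [mem_setOf_eq, mem_image, mem_prod, Prod.exists]
        constructor
        · rintro ⟨y, hy, t, ht, rfl⟩; exact ⟨y, t, ⟨hy, ht⟩, rfl⟩
        · rintro ⟨y, t, ⟨hy, ht⟩, rfl⟩; exact ⟨y, hy, t, ht, rfl⟩
      rw [he]
      exact ((hFcpt.prod isCompact_Icc).image hc).isClosed.measurableSet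
    rw [hprism, hTvol _ hWm, volume_prism_shear Fc hν hpl w] at h1
    have hfin : volume {x : E3 | ∃ y ∈ Fc, ∃ t ∈ Icc (0 : ℝ) 1, x = y + t • ν} ≠ ⊤ := by
      have hc : Continuous fun q : E3 × ℝ => q.1 + q.2 • ν :=
        continuous_fst.add (continuous_snd.smul continuous_const)
      have he : {x : E3 | ∃ y ∈ Fc, ∃ t ∈ Icc (0 : ℝ) 1, x = y + t • ν} =
          (fun q : E3 × ℝ => q.1 + q.2 • ν) '' (Fc ×ˢ Icc (0 : ℝ) 1) := by
        ext x
        simp only [mem_setOf_eq, mem_image, mem_prod, Prod.exists]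
        constructor
        · rintro ⟨y, hy, t, ht, rfl⟩; exact ⟨y, t, ⟨hy, ht⟩, rfl⟩
        · rintro ⟨y, t, ⟨hy, ht⟩, rfl⟩; exact ⟨y, hy, t, ht, rfl⟩
      rw [he]
      exact ((hFcpt.prod isCompact_Icc).image hc).measure_lt_top.ne
    refine h1.trans (le_of_eq ?_)
    rw [facetArea, ENNReal.ofReal_mul (abs_nonneg _), ENNReal.ofReal_toReal hfin]
  -- the estimate in coordinates
  obtain ⟨ρ₀, hρ₀, hest⟩ := Chimera.volume_lineTrim_le_shadow hPo' hQo' hPv' hQv' hPQ' hQb' hε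
  refine ⟨ρ₀, hρ₀, fun ρ hρ hρρ₀ => ?_⟩
  have hmeas : MeasurableSet (Q ∩ {x : E3 | ∃ s ∈ Icc (-ρ) ρ, x + s • w ∈ P}) := by
    have e : {x : E3 | ∃ s ∈ Icc (-ρ) ρ, x + s • w ∈ P} =
        ⋃ (s : ℝ) (_ : s ∈ Icc (-ρ) ρ), (fun x => x + s • w) ⁻¹' P := by ext x; simp
    rw [e]
    exact hQo.measurableSet.inter (isOpen_iUnion fun s => isOpen_iUnion fun _ =>
      (continuous_id.add continuous_const).isOpen_preimage _ hPo).measurableSet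
  have h := hest ρ hρ hρρ₀
  rw [hcl, ← htrimimg, hTvol _ hmeas] at h
  have h2 : volume (Q ∩ {x : E3 | ∃ s ∈ Icc (-ρ) ρ, x + s • w ∈ P}) ≤
      ENNReal.ofReal ρ * (ENNReal.ofReal (|⟪w, ν⟫_ℝ| * facetArea Fc ν) + ENNReal.ofReal ε) :=
    h.trans (by gcongr)
  have hne : ENNReal.ofReal ρ * (ENNReal.ofReal (|⟪w, ν⟫_ℝ| * facetArea Fc ν) + ENNReal.ofReal ε) ≠ ⊤ :=
    ENNReal.mul_ne_top ENNReal.ofReal_ne_top (ENNReal.add_ne_top.2 ⟨ENNReal.ofReal_ne_top, ENNReal.ofReal_ne_top⟩)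
  have h3 := ENNReal.toReal_mono hne h2
  have hfa : 0 ≤ |⟪w, ν⟫_ℝ| * facetArea Fc ν := mul_nonneg (abs_nonneg _) ENNReal.toReal_nonneg
  rw [ENNReal.toReal_mul, ENNReal.toReal_add ENNReal.ofReal_ne_top ENNReal.ofReal_ne_top,
    ENNReal.toReal_ofReal hρ.le, ENNReal.toReal_ofReal hfa, ENNReal.toReal_ofReal hε.le] at h3
  exact h3

end Summit.Ventures.Crystal3D.Theorems

end
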